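/-
Copyright: the b2b-balaban T⁴-continuum CRUX team, row NE7b OWNER lineage `t4-ne7b-p1` (gen 124). Project licence.
-/
import Summits.QuantumFields.BalabanUV.T4Continuum.Spine.NE7b.SupZdCoarseInverseIdentities
import Summits.QuantumFields.BalabanUV.T4Continuum.Spine.NE7b.OneShotChartTorusRowsZd

/-!
# THE INFINITE-VOLUME NEXT-SCALE HESSIAN KERNEL IS TRANSLATION COVARIANT: translating the background potential by a coarse vector,
# `V ↦ V(· + (n+1)t)`, translates the bounded block columns, the coarse operator `T_∞` and its inverse: `M′(b,b′) = M(b + t, b′ + t)`; in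
# particular at a `t`-INVARIANT background (`V(· + (n+1)t) = V`, e.g. a constant field) `M(b + t, b′ + t) = M(b, b′)` — the next-scale
# Hessian is a CONVOLUTION kernel, so its constant-background value is a function of `b − b′` alone (every mesh, `d ≥ 3`); the cube sections
# break the symmetry, their limit restores it by (195)'s uniqueness of the bounded inverse (row NE7b, node U5c; (181)∕(194)∕(195) + (55) BY
# NAME; [folklore])

Cell `pub-balaban`, sub-cell `t4`, spine estimate NE7b (`T4WeightBudget.RelWeightBound`; the cell's OWN estimate — NOT PRINTED in
[Bałaban 1983–89], NOT PROVED).  Crux-route work under `Spine/NE7b/` by the row OWNER (`t4-ne7b-p1` gen 124, file (207)) under FREEZE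
(0)'s crux-prover clause; NOTHING of Bałaban's is named as a Lean object, valued or asserted; no `T4Continuum/Support` leaf typed; no `def`,
no notation (translated data WRITTEN OUT; `M`, `M′` ANY cube limits for the displayed data); zero `sorry`.  Imports (BY NAME): the OWNER's
(195) `…SupZdCoarseInverseIdentities` (`zd_coarse_mul_inverse`, `zd_coarse_right_inverse_unique`; through it (194) `zd_coarse_section_inverse`,
(181) `zd_bounded_solution_unique`), (55) `…OneShotChartTorusRowsZd` (`blk_translate`, `sum_B_translate`), Mathlib's `Equiv.tsum_eq`
(`Equiv.addRight`).

WHY (located).  The road's estimates are stated "uniformly in the background field"; at the distinguished translation-invariant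
backgrounds (constants — the small-field minimisers) the next-scale Hessian should be a convolution operator, so that its symbol ∕
effective mass are numbers, not kernels — the form in which a weight budget like NE7b reads them.  On `ℤ^d` (no torus wrap, (194)∕(195))
this is a three-line consequence of uniqueness: the fine translation by `(n+1)t` commutes with the displayed operator and shifts blocks
by `t` ((55)), so `Ψ′_{b′} = Ψ_{b′+t}(· + (n+1)t)` are block columns of `H_{V(·+(n+1)t)}` and `T′ = T(· + t, · + t)`; the kernel
`M(· + t, · + t)` is bounded and `Σ′_{b″}T′(b,b″)M(b″ + t, b′ + t) = Σ′_cT(b + t, c)M(c, b′ + t) = δ_{bb′}` (reindex the `ℤ^d` series by the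
bijection `b″ ↦ b″ + t`), hence it IS the cube limit `M′` ((195) `zd_coarse_right_inverse_unique`); if `V` is `t`-invariant then so are the
block columns ((181)), the translated data coincide with the original, and `M′ = M`.

WHAT IS PROVED ([folklore]; `X d = ℤ^d`, `side n = n + 1`): §1 `blockColumns_translate`, `coarse_translate`; §2 **`zd_coarse_inverse_translate`**
(cube limits `M` for `(V, Ψ)` and `M′` for the translated data ⟹ `M′(b,b′) = M(b + t, b′ + t)`); §3 **`zd_coarse_inverse_translation_invariant`**
(`V(· + (n+1)t) = V` ⟹ `M(b + t, b′ + t) = M(b,b′)`); §4 toy.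

HONEST (what this is NOT).  Covariance under COARSE translations only (fine translations by non-multiples of `n+1` move the block
partition); lattice rotations∕reflections are not typed; the LINEAR column only; `d ≥ 3` only; scalar skeleton ((A3), NC-NE7b-α UNRULED);
nothing of the covariant propagators of [B4]–[B6]; nothing of Bałaban's asserted.  BY-NAME EFFECT ON THE WALL: NONE.  NE7b NOT PRINTED ∕ NOT
PROVED; spine PROVED 0∕9; rung (B)+1 — the programme's measures remain FINITE-torus statements; NOT the mass gap, NOT Clay.  HONEST
DEPENDENCY: continuum YM on T⁴ ⇐ BetaPertH ∧ nine spine estimates (0∕9 proved); BetaPertH ⇐ (D1) ∧ (D4) ∧ CAP+tail; G-an2-4 gates asym,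
D1 and NE2∕3∕4.
-/

set_option autoImplicit false

noncomputable section

namespace Summit.QuantumFields.BalabanUV.T4Continuum.NE7b.SupZdCoarseInverseCovariance

open Real Filter Topology
open Literature.MathematicalPhysics.QuantumFieldTheory.Balaban1983to89
open B6QGQLower276 (X e blk B side chart mem_B sum_B sum_B_const card_cube blk_chart)
open OneShotChartTorusRowsZd (blk_translate sum_B_translate)
open SupZdPropagatorUniqueness (zd_bounded_solution_unique)
open SupZdCoarseInverse (zd_coarse_section_inverse)
open SupZdCoarseInverseIdentities (zd_coarse_mul_inverse zd_coarse_right_inverse_unique)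

variable {d : ℕ}

/-! ## §1. Coarse translations act on the data: block columns and the coarse operator translate -/

/-- **TRANSLATED BLOCK COLUMNS**: if `Ψ` are bounded block columns of `H_V` on `ℤ^d`, then `Ψ′_{b′}(p) = Ψ_{b′+t}(p + (n+1)t)` are bounded
block columns of `H_{V(· + (n+1)t)}` — the displayed operator commutes with the fine translation by `(n+1)t`, under which blocks shift by
`t` ((55) `blk_translate`, `sum_B_translate`). [folklore] -/
theorem blockColumns_translate (n : ℕ) (a : ℝ) (V : X d → ℝ) (Ψ : X d → X d → ℝ) (t : X d)
    (hΨ : ∀ b' p, ((n : ℝ) + 1) ^ 2 * ∑ μ, (2 * Ψ b' p - Ψ b' (p + e μ) - Ψ b' (p - e μ))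
      + a / ((n : ℝ) + 1) ^ d * ∑ q ∈ B n (blk n p), Ψ b' q + V p * Ψ b' p = if blk n p = b' then 1 else 0) (b' p : X d) :
    ((n : ℝ) + 1) ^ 2 * ∑ μ, (2 * Ψ (b' + t) (p + side n • t) - Ψ (b' + t) (p + e μ + side n • t) - Ψ (b' + t) (p - e μ + side n • t))
      + a / ((n : ℝ) + 1) ^ d * ∑ q ∈ B n (blk n p), Ψ (b' + t) (q + side n • t)
      + V (p + side n • t) * Ψ (b' + t) (p + side n • t) = if blk n p = b' then 1 else 0 := by
  have h := hΨ (b' + t) (p + side n • t)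
  rw [blk_translate, sum_B_translate] at h
  have e1 : ∀ μ, p + side n • t + e μ = p + e μ + side n • t := fun μ => by abel
  have e2 : ∀ μ, p + side n • t - e μ = p - e μ + side n • t := fun μ => by abel
  simp only [e1, e2] at h
  rw [h]
  by_cases hb : blk n p = b'
  · rw [if_pos hb, if_pos (by rw [hb])]
  · rw [if_neg hb, if_neg (fun h' => hb (add_right_cancel h'))]

/-- **THE COARSE OPERATOR TRANSLATES**: with `Ψ′` as above, `T′(b,b′) = (n+1)^{−d}Σ_{q ∈ B n b}Ψ′_{b′}(q) = T(b + t, b′ + t)`. [folklore] -/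
theorem coarse_translate (n : ℕ) (Ψ : X d → X d → ℝ) (t b b' : X d) :
    (((n : ℝ) + 1) ^ d)⁻¹ * ∑ q ∈ B n b, Ψ (b' + t) (q + side n • t) = (((n : ℝ) + 1) ^ d)⁻¹ * ∑ q ∈ B n (b + t), Ψ (b' + t) q := by
  rw [sum_B_translate]

/-! ## §2. THE END: the infinite-volume next-scale Hessian kernel is translation covariant -/

/-- **HEADLINE — TRANSLATION COVARIANCE OF `M = T_∞⁻¹`**: `d ≥ 3`, `a > 0`, `λ < min(2,a)`, `Λ ≥ 0`; `V : ℤ^d → [−λ, Λ]`, `Ψ` bounded block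
columns of `H_V`, `M` a cube limit for `(V, Ψ)` ((194)); for a coarse vector `t` let `V′ = V(· + (n+1)t)`, `Ψ′_{b′} = Ψ_{b′+t}(· + (n+1)t)`
(block columns of `H_{V′}`, §1) and `M′` a cube limit for `(V′, Ψ′)`.  Then `M′(b,b′) = M(b + t, b′ + t)` — the translated kernel is a
bounded right inverse of `T′ = T(· + t, · + t)` (reindexing the `ℤ^d` series by `b″ ↦ b″ + t`), hence THE inverse by (195)'s uniqueness.
The cube sections are not translation invariant; their limit is. [folklore] -/
theorem zd_coarse_inverse_translate (hd : 3 ≤ d) (a : ℝ) (ha : 0 < a) {lam Lam : ℝ} (hlam : lam < min 2 a) (hLam : 0 ≤ Lam)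
    (n : ℕ) (V : X d → ℝ) (hV : ∀ p, -lam ≤ V p) (hV' : ∀ p, V p ≤ Lam)
    (Ψ : X d → X d → ℝ) (BΨ : X d → ℝ) (hΨB : ∀ b' p, |Ψ b' p| ≤ BΨ b')
    (hΨ : ∀ b' p, ((n : ℝ) + 1) ^ 2 * ∑ μ, (2 * Ψ b' p - Ψ b' (p + e μ) - Ψ b' (p - e μ))
      + a / ((n : ℝ) + 1) ^ d * ∑ q ∈ B n (blk n p), Ψ b' q + V p * Ψ b' p = if blk n p = b' then 1 else 0)
    (M : X d → X d → ℝ) (hM : ∀ b b' : X d, Tendsto (fun R : ℕ =>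
        if h : b ∈ (Fintype.piFinset fun _ : Fin d => Finset.Icc (-(R : ℤ)) R) ∧
            b' ∈ (Fintype.piFinset fun _ : Fin d => Finset.Icc (-(R : ℤ)) R)
          then (Matrix.of fun c c' : ↥(Fintype.piFinset fun _ : Fin d => Finset.Icc (-(R : ℤ)) R) =>
            (((n : ℝ) + 1) ^ d)⁻¹ * ∑ q ∈ B n (c : X d), Ψ (c' : X d) q)⁻¹ ⟨b, h.1⟩ ⟨b', h.2⟩ else 0)
      atTop (𝓝 (M b b')))
    (t : X d) (M' : X d → X d → ℝ) (hM' : ∀ b b' : X d, Tendsto (fun R : ℕ =>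
        if h : b ∈ (Fintype.piFinset fun _ : Fin d => Finset.Icc (-(R : ℤ)) R) ∧
            b' ∈ (Fintype.piFinset fun _ : Fin d => Finset.Icc (-(R : ℤ)) R)
          then (Matrix.of fun c c' : ↥(Fintype.piFinset fun _ : Fin d => Finset.Icc (-(R : ℤ)) R) =>
            (((n : ℝ) + 1) ^ d)⁻¹ * ∑ q ∈ B n (c : X d), Ψ ((c' : X d) + t) (q + side n • t))⁻¹ ⟨b, h.1⟩ ⟨b', h.2⟩ else 0)
      atTop (𝓝 (M' b b')))
    (b b' : X d) : M' b b' = M (b + t) (b' + t) := by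
  classical
  -- the translated data are in the class
  have hV₂ : ∀ p, -lam ≤ V (p + side n • t) := fun p => hV _
  have hV₂' : ∀ p, V (p + side n • t) ≤ Lam := fun p => hV' _
  have hΨ₂B : ∀ b' p, |Ψ (b' + t) (p + side n • t)| ≤ BΨ (b' + t) := fun b' p => hΨB _ _
  have hΨ₂ := blockColumns_translate n a V Ψ t hΨ
  -- `M` is bounded (cube limit of the uniformly decaying section inverses)
  obtain ⟨c₁, δ₁, hc₁, hδ₁, H4⟩ := zd_coarse_section_inverse (d := d) hd a ha hlam hLam
  have hMB : ∀ c c', |M c c'| ≤ c₁ := fun c c' => by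
    refine le_of_tendsto' (hM c c').abs fun R => ?_
    split_ifs with h
    · refine ((H4 n V hV hV' Ψ BΨ hΨB hΨ _ _ (Finset.Subset.refl _)).1 ⟨c, h.1⟩ ⟨c', h.2⟩).trans ?_
      exact mul_le_of_le_one_right hc₁.le (exp_le_one_iff.2 (neg_nonpos.2 (by positivity)))
    · rw [abs_zero]; exact hc₁.le
  -- the translated kernel is a bounded right inverse of the translated coarse operator
  have hright : ∀ c c' : X d, ∑' c'' : X d, ((((n : ℝ) + 1) ^ d)⁻¹ * ∑ q ∈ B n c, Ψ (c'' + t) (q + side n • t)) * M (c'' + t) (c' + t)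
      = if c = c' then 1 else 0 := by
    intro c c'
    have h := (zd_coarse_mul_inverse hd a ha hlam hLam n V hV hV' Ψ BΨ hΨB hΨ M hM (c + t) (c' + t)).2
    rw [← (Equiv.addRight t).tsum_eq] at h
    simp only [Equiv.coe_addRight] at h
    simp only [coarse_translate]
    rw [h]
    by_cases hc : c = c'
    · rw [if_pos hc, if_pos (by rw [hc])]
    · rw [if_neg hc, if_neg (fun h' => hc (add_right_cancel h'))]
  exact (zd_coarse_right_inverse_unique hd a ha hlam hLam n (fun p => V (p + side n • t)) hV₂ hV₂' (fun b' p => Ψ (b' + t) (p + side n • t))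
    (fun b' => BΨ (b' + t)) hΨ₂B hΨ₂ M' hM' (fun c c' => M (c + t) (c' + t)) c₁ (fun c c' => hMB _ _) hright b b').symm

/-! ## §3. Translation-invariant backgrounds: the Hessian kernel is a convolution -/

/-- **COROLLARY — AT A `t`-INVARIANT BACKGROUND THE KERNEL IS `t`-INVARIANT**: if `V(p + (n+1)t) = V(p)` for all `p` (e.g. a constant
background), then the bounded block columns are covariant, `Ψ_{b′+t}(p + (n+1)t) = Ψ_{b′}(p)` ((181)), the translated cube limit is `M`
itself, and `M(b + t, b′ + t) = M(b, b′)` — the infinite-volume next-scale Hessian at a translation-invariant background is a convolution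
kernel. [folklore] -/
theorem zd_coarse_inverse_translation_invariant (hd : 3 ≤ d) (a : ℝ) (ha : 0 < a) {lam Lam : ℝ} (hlam : lam < min 2 a) (hLam : 0 ≤ Lam)
    (n : ℕ) (V : X d → ℝ) (hV : ∀ p, -lam ≤ V p) (hV' : ∀ p, V p ≤ Lam) (t : X d) (hVt : ∀ p, V (p + side n • t) = V p)
    (Ψ : X d → X d → ℝ) (BΨ : X d → ℝ) (hΨB : ∀ b' p, |Ψ b' p| ≤ BΨ b')
    (hΨ : ∀ b' p, ((n : ℝ) + 1) ^ 2 * ∑ μ, (2 * Ψ b' p - Ψ b' (p + e μ) - Ψ b' (p - e μ))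
      + a / ((n : ℝ) + 1) ^ d * ∑ q ∈ B n (blk n p), Ψ b' q + V p * Ψ b' p = if blk n p = b' then 1 else 0)
    (M : X d → X d → ℝ) (hM : ∀ b b' : X d, Tendsto (fun R : ℕ =>
        if h : b ∈ (Fintype.piFinset fun _ : Fin d => Finset.Icc (-(R : ℤ)) R) ∧
            b' ∈ (Fintype.piFinset fun _ : Fin d => Finset.Icc (-(R : ℤ)) R)
          then (Matrix.of fun c c' : ↥(Fintype.piFinset fun _ : Fin d => Finset.Icc (-(R : ℤ)) R) =>
            (((n : ℝ) + 1) ^ d)⁻¹ * ∑ q ∈ B n (c : X d), Ψ (c' : X d) q)⁻¹ ⟨b, h.1⟩ ⟨b', h.2⟩ else 0)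
      atTop (𝓝 (M b b')))
    (b b' : X d) : M (b + t) (b' + t) = M b b' := by
  classical
  -- the block columns are covariant
  have hΨ₂ := blockColumns_translate n a V Ψ t hΨ
  simp only [hVt] at hΨ₂
  have hcov : ∀ b', (fun p => Ψ (b' + t) (p + side n • t)) = Ψ b' := fun b' =>
    zd_bounded_solution_unique hd a ha hlam hLam n V hV hV' _ (fun p => Ψ (b' + t) (p + side n • t)) (Ψ b')
      (fun p => hΨB _ _) (hΨB b') (hΨ₂ b') (hΨ b')
  have hcov' : ∀ b' q, Ψ (b' + t) (q + side n • t) = Ψ b' q := fun b' q => congrFun (hcov b') q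
  -- so the translated cube limit has the SAME defining sequence as `M`
  refine (zd_coarse_inverse_translate hd a ha hlam hLam n V hV hV' Ψ BΨ hΨB hΨ M hM t M (fun c c' => ?_) b b').symm
  simp only [hcov']
  exact hM c c'

/-! ## §4. Toy -/

/-- Toy (`d = 2`, `n = 1`): the coarse operator's translate, checked on the zero kernel. -/
example (t b b' : X 2) :
    ((((1 : ℕ) : ℝ) + 1) ^ 2)⁻¹ * ∑ q ∈ B 1 b, (fun _ _ => (0 : ℝ)) (b' + t) (q + side 1 • t)
      = ((((1 : ℕ) : ℝ) + 1) ^ 2)⁻¹ * ∑ q ∈ B 1 (b + t), (fun _ _ => (0 : ℝ)) (b' + t) q :=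
  coarse_translate (d := 2) 1 (fun _ _ => 0) t b b'

end Summit.QuantumFields.BalabanUV.T4Continuum.NE7b.SupZdCoarseInverseCovariance
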